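import Mathlib
import Literature.MathematicalPhysics.QuantumFieldTheory.Balaban1983to89.T4CouplingAnalyticity
import Literature.MathematicalPhysics.QuantumFieldTheory.Balaban1983to89.FlowStep
import Literature.MathematicalPhysics.QuantumFieldTheory.Balaban1983to89.BetaDerivClause

/-!
# `Balaban1983to89.B12CouplingClausesHistory` — the PRINTED coupling-regularity clauses of [Balaban1987RG1] (p. 263 «C^∞
(or analytic) in g_{j−1}», p. 264 β-clause, p. 266 «analytic functions of the effective coupling constants», with p. 256 /
p. 298 «depends also on all preceding coupling constants») in HISTORY-EXPLICIT typing

statement-level skeleton of published theorems with citation tags; proofs where landed; nothing here is a claim about the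
Yang–Mills mass gap

CITATION HEADER (lean-in-tree rule 2026-08-18).  Source: T. Bałaban, *Renormalization group approach to lattice gauge field
theories. I. Generation of effective actions in a small field approximation and a coupling constant renormalization in four
dimensions*, Commun. Math. Phys. **109** (1987) 249–301, doi:10.1007/bf01215223 [Balaban1987RG1] (cell paper B12 = [I]; held
`paper:balaban1987-cmp109-rg-i-small-field`, journal page = PDF page + 248; every sentence quoted below was re-read by this seat
on the text layer, pages p0008 / p0015 / p0016 / p0018 / p0050, the p. 266 sentence also on the ×2 render
`b2b-balaban-ref1/pages/1987-cmp109-rg-I-small-field/…-p018-x2.png`, 2026-08-26).  THE PRINT, VERBATIM: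
* p. 256 [PDF 8] ll. 33–40: *«The function E_k depends also on the effective coupling constants g₀, …, g_{k−1}. It is a sum of
  contributions coming from the k successive integrations in the k renormalization transformations. … In the second step a new
  expression of this type is created, in the old only a background field is changed. Thus we obtain after k steps (0.23).»*
* p. 263 [PDF 15] ll. 22–28: *«We assume that the function E^{(j)}(X, g_{j−1}, 𝐔, 𝐉) is defined and analytic on the space
  U^c_j(X, α₀, α₁), with some positive, absolute constants α₀, α₁ (i.e., constants independent of X and j). It depends on the
  configurations restricted to X, i.e. on (𝐔, 𝐉)|_X. It is a C^∞-function of g_{j−1} ∈ [0, γ], (or analytic), with a positive,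
  absolute γ.»*
* p. 264 [PDF 16] ll. 25–27, of `β_{j+1}(g_j)` defined by (1.22): *«It is a smooth function defined on the interval [0, γ], (or
  analytic), uniformly bounded on this interval together with all derivatives. We will investigate other properties in a
  separate paper.»*
* p. 266 [PDF 18] ll. 33–37, after (2.9): *«Another possibility is to take g_k/γ_kε₁ instead of ε₁, where γ_k = C log(L^kε)^{−1}
  with C sufficiently large. It has the advantage that the functions E^{(j)}, β_j are analytic functions of the effective coupling
  constants, but it has some disadvantages in perturbative calculations also. We have formulated the implications of both
  possibilities in the inductive description.»*
* p. 298 [PDF 50] ll. 37–39: *«We write β_j as explicitly dependent on g_{j−1} although it depends also on all preceding coupling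
  constants. The dependence on g_{j−1} is important and it determines main properties of the renormalization group equations.»*

WHY THIS MODULE (cell `lit-balaban`, R141 (B) typer seat `lit-balaban-type-NE-I`, row «[I] p. 263 C^∞ history dependence →
N22; coordinate with node00-def-W1»).  Every one of the five sentences is ALREADY typed in the tree — but in MARKOV typing, with
the coupling history suppressed (one `Step.SFTower` per history: `B12BetaSmooth.ESmoothHyp` / `ESmoothAt` / `EAnalyticAt` /
`BetaAnalyticAt`, `B12StepObligation.BetaSmoothAt`, `B12BetaHolo.EHoloAt`; typing note (2) of `B12BetaSmooth`: *«the history is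
suppressed (one tower per history; Markov typing D-f2.4/G-adv2-4)»*).  The consumers of DAG node N22 (spine estimate NE9 =
`T4OutputRate.NE9 ∧ T4OutputRate.FadingMemory`, NOT PRINTED) and the definer of the history-Lipschitz OBJECT W1
(`Node00.W1`, [Balaban1988RG2Cluster] §2 (2.13)–(2.14) on the record's torus catalogue) work in the HISTORY-EXPLICIT currency
`T4OutputRate.Functional C Bg = (ℕ → ℝ) → Bg → C.Dom → ℝ` (coupling history, configuration, localization domain) and
`FlowStep.HBeta` (β-side); there the tree holds only QUANTITATIVE shapes that print does NOT give (`T4CouplingAnalyticity.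
CouplingAnalytic(On)` — coordinate-disc analyticity with radii and a bound; `CoordLipschitzOn`; `T4CouplingMatching.HistLipschitz`;
`BetaDerivClause.*`), plus the two printed-in-words binders `T4OutputRate.PrefixDependenceOn` (p. 256 / p. 298) and
`FlowStep.BetaContH`.  What was NOT typed is the printed QUALITATIVE TYPE itself in that currency — and it is exactly what the
N22 road-3 slots cite as their provenance (`Summits/…/BalabanUVNodesN22AtRecordStrip` header: *«(A′) = the printed TYPE «(or
analytic)» ([Balaban1987RG1] p. 263; p. 266, plural) in EACH young coupling»*).  This module types it, as hypothesis SCHEMAS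
(predicates with explicit carriers; ASSERTED NOWHERE — consumed only as hypotheses), and kernel-checks the elementary links.

WHAT IS TYPED (generic carriers: a localization-domain index `Dom` with creation step `scale : Dom → ℕ`, a configuration type `Φ`
with a space table `sp : Dom → Set Φ` — print's `U^c_j(X, α₀, α₁)`; for `T4OutputRate.Functional` take `sp = fun _ => univ`, the
backgrounds being «already restricted» there — values in a real normed space `F` (`ℝ` for the real terms, `ℂ` for their analytic
extensions (1.9)); a history set `W ⊆ (ℕ → ℝ)` (print: the window `]0, γ]^ℕ` of Theorems 1/3 = `T4OutputRate.Window γ`) and a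
coordinate set `I ⊆ ℝ` on which the regularity is asserted (print, p. 263 / p. 264: `I = [0, γ]`)):
* §1 `spliceHistory` — replace the prefix `(g₀, …, g_{j−1})` of a history by a vector `v : Fin j → ℝ` (bookkeeping for the joint
  form; `spliceHistory_update` identifies the one-coordinate sections; the insertion lemmas `analyticOn_update` /
  `mapsTo_update_pi` and §5's `box_subset_IccCube` are private plumbing).
* §2 p. 263 in history-explicit form: `SmoothInLast263` (for every frozen older history `h ∈ W`, every domain `X` and every
  configuration in `sp X`, the LAST-coupling section `s ↦ E (h[scale X − 1 := s]) φ X` is `C^∞` on `I`), `AnalyticInLast263`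
  («(or analytic)»: real-analytic within `I`, the reading of `B12BetaSmooth.EAnalyticAt`).
* §3 p. 266 (PLURAL, under the alternative cut-off `g_k/γ_k ε₁` — tree `B12SmallFieldDomain259.chiFluctPrintedAlt` / `gammaK`):
  `AnalyticInCouplings266` (JOINT real analyticity of `v ↦ E (spliceHistory (scale X) v h) φ X` on the cube `I^{scale X}`),
  its coordinatewise consequence `AnalyticInEachCoupling266` (every young-coupling section `s ↦ E (h[i := s]) φ X`, `i < scale X`,
  analytic within `I`) and `SmoothInEachCoupling266`; kernel links `analyticInEachCoupling266_of_analyticInCouplings266`,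
  `analyticInLast263_of_each`, `smoothInEachCoupling266_of_analytic`, `smoothInLast263_of_analytic`, `smoothInLast263_of_each`.
* §4 THE DIRECTION OF THE CELL'S QUANTITATIVE SHAPES: a complex-differentiable extension near each point of `I` gives real
  analyticity within `I` (private `analyticWithinAt_of_complexExtension`, `analyticOn_of_complexExtension`); hence
  `T4CouplingAnalyticity.CouplingAnalyticOn I E κ M r` with positive radii IMPLIES `AnalyticInEachCoupling266 (BoxWindow I) I`
  (`analyticInEachCoupling266_of_couplingAnalyticOn`), and so does the open-disc derivative-letter currency (A′) of the N22 strip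
  slot (`analyticInEachCoupling266_of_openDiscs`).  The CONVERSE is the unprinted content of NE9's road 3 (uniform radius,
  derivative letter, growth in the age) — nothing here supplies it.
* §5 β-side over `FlowStep.HBeta` (`β k p = β_{k+1}(g₀, …, g_k)`): `BetaSmoothInLast264` (p. 264 for every frozen history
  `p ∈ FlowStep.Box γ k`: `s ↦ β k (p[last := s])` is `C^∞` on `[0, γ]`), `BetaAnalyticInLast264` («(or analytic)»),
  `BetaDerivsBoundedInLast264` («uniformly bounded on this interval together with all derivatives», WEAKEST reading: per scale
  and per frozen history, one bound per order, uniform in `g_k ∈ [0, γ]`; print does not DECIDE between this per-scale reading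
  and the j- and history-UNIFORM one — §6 types the latter), `BetaAnalyticInCouplings266` (p. 266 plural: `β k` jointly
  real-analytic within the closed cube `[0, γ]^{k+1}`); links `betaSmoothInLast264_of_analytic`, `betaAnalyticInLast264_of_couplings`,
  `betaContH_of_analyticInCouplings266` (p. 266 ⇒ the tree's `FlowStep.BetaContH`, which `BetaDerivClause`'s header records as
  «not even ASSERTED in print for the earlier variables» — under the p. 266 alternative it IS asserted), and the Markov bridge
  `betaSmoothInLast264_ofMarkov_iff` (for `FlowStep.ofMarkov βM` the clause is `∀ k n, ContDiffOn ℝ n (βM (k+1)) [0, γ]`, the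
  currency of `Step.SFHyp.betaSmooth`).
* §6 (v1.1) the j- and history-UNIFORM all-orders reading of the same p. 264 sentence: `BetaDerivsUniformInLast264 γ β b` (ONE
  table of constants `b : ℕ → ℝ`: `‖∂ⁿ_s β_{k+1}(g₀, …, g_{k−1}, s)‖ ≤ b n` for every order `n`, scale `k`, frozen history
  `p ∈ ]0, γ]^{k+1}` and `s ∈ [0, γ]` — the constants of §1 being «absolute», «independent of X and j», this reading is at least as
  printable as §5's per-scale one: referee reading note D-g113-1 of `lit-balaban-ref-4` on v1, adopted); bridges
  `betaDerivsBoundedInLast264_of_uniform` (⇒ §5's weakest reading), `betaDerivsUniformInLast264_mono`, `abs_le_of_uniform` (order 0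
  on the diagonal: `|β k p| ≤ b 0` on every box), `betaUpperH_of_uniform` / `betaLowerH_of_uniform` (order 0 ⇒ the tree's
  `FlowStep.BetaUpperH (b 0)` / `BetaLowerH (−b 0)`, the flow inputs of Theorem 2's shooting), `lastVarDerivBound_of_uniform`
  and `lastVarLipschitz_of_uniform` (order 1, with `BetaSmoothInLast264`, ⇒ the cell's `BetaDerivClause.LastVarDerivBound β (b 1) γ`
  / `LastVarLipschitz` — the k- and history-uniform first-order hypotheses whose header calls the uniformity unprinted: this is
  their printed provenance IN THE UNIFORM READING, and only in it), `betaDerivsUniformInLast264_ofMarkov_iff` (Markov family: the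
  all-`k` form of `B12BetaSmooth.BetaDerivBoundsAt`'s shape `|∂ⁿ(βM (k+1))| ≤ b n` on `[0, γ]`).

HONEST SCOPE.  (i) Nothing of Bałaban's is asserted: every `def` is a predicate, every `theorem` elementary analysis /
bookkeeping.  (ii) Print gives NO radius of analyticity, NO bound on any g-derivative of `E^{(j)}`, NO uniformity in `j` or in the
history for `E^{(j)}`'s coupling dependence, and NOTHING quantitative about the dependence on the OLDER couplings `g₀, …, g_{j−2}`
(cell GAPS G-t4-U3-3, G-t4-U3-4, G-adv2-6; `T4CouplingAnalyticity` header (L3)); for `β_{j+1}` it prints boundedness of all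
`g_j`-derivatives on `[0, γ]` and leaves the uniformity reading open (§5 weakest / §6 uniform; no constants, no proof in [I]
§§2–5 or [II]): the schemas below carry exactly that much and no more.  (iii) The p. 266 sentence is
stated for a DIFFERENT small-field cut-off (`g_k/γ_k ε₁`, `γ_k = C log(L^kε)^{−1}` depending on the number of remaining scales);
a consumer assuming `AnalyticInCouplings266` for a functional assumes it for the functional OF THAT CONSTRUCTION.  (iv) «analytic»
is typed as real analyticity WITHIN the coordinate set (`AnalyticOn ℝ`, Mathlib's within-set notion: at each point the function
agrees near the point, within the set, with a convergent power series) — the weakest faithful reading, as in `B12BetaSmooth`;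
print names no complex neighbourhood.  (v) The history set `W` and the coordinate set `I` are parameters: print's histories live
in `]0, γ]` (Theorem 3 p. 264: *«0 < g_k ≤ γ for k = 0, 1, …, K»*) while the regularity variable of p. 263 / p. 264 ranges over
the CLOSED `[0, γ]`; both readings are instances.  (vi) «in the old only a background field is changed» (p. 256) = the scale-`j`
term is ONE function of the history read at every later step; in the `Functional` currency this is built in (the domain index
carries the creation step) and its coupling content is `T4OutputRate.PrefixDependenceOn` (cited, not restated).

R141 (B) typer seat `lit-balaban-type-NE-I` (literature-prover-lit-balaban-type-NE-I-g0-0; v1.1 -g2-0), `--supports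
stmt-QuantumFields-19676` (K3 `SpineGivenEndpointR11`: the spine estimates N14–N22).  SKELETON rows touched (cells only, zero head
weight; owner r09): B12.Eq1.18 (p. 263 clause), B12.Eq1.22 (p. 264 β-clause), B12.Eq2.9 (p. 266 remark), B12.Txt@298, B12.Eq0.23
(p. 256).  Imports `T4CouplingAnalyticity` (for `T4OutputRate.Functional` / `Window` / `BoxWindow` / `CouplingAnalyticOn`), `FlowStep`
(`HBeta`, `Box`, `BetaContH`, `BetaUpperH`, `BetaLowerH`, `ofMarkov`) and `BetaDerivClause` (`LastVarDerivBound`, `LastVarLipschitz`);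
no `instance`, no `notation`, no `sorry` / `axiom`.

VERSIONS.  v1 p454833 (2026-08-26): §§1–5.  v1.1 (same seat, gen 2): APPEND-ONLY — every v1 declaration byte-identical in
STATEMENT (one docstring reworded: `BetaDerivsBoundedInLast264`, per referee reading note D-g113-1: print does not decide between
the per-scale and the j-uniform reading of p. 264's «uniformly bounded … together with all derivatives»); NEW §6 = the j- and
history-uniform reading `BetaDerivsUniformInLast264` with its bridges to `FlowStep.BetaUpperH` / `BetaLowerH` and
`BetaDerivClause.LastVarDerivBound` / `LastVarLipschitz`; +1 import (`BetaDerivClause`).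
-/

noncomputable section

open Set Filter Topology Metric

namespace Literature.MathematicalPhysics.QuantumFieldTheory.Balaban1983to89.B12CouplingClausesHistory

open Literature.MathematicalPhysics.QuantumFieldTheory.Balaban1983to89
open Literature.MathematicalPhysics.QuantumFieldTheory.Balaban1983to89.T4OutputRate
open Literature.MathematicalPhysics.QuantumFieldTheory.Balaban1983to89.T4CouplingAnalyticity
open Literature.MathematicalPhysics.QuantumFieldTheory.Balaban1983to89.FlowStep

/-! ## §1 Histories: splicing a prefix (bookkeeping for p. 256 «depends also on g₀, …, g_{k−1}») -/

/-- Replace the prefix `(h 0, …, h (j−1))` of a coupling history `h` by the vector `v : Fin j → ℝ`, keeping `h` from coordinate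
`j` on.  (The scale-`j` term reads only the prefix — `T4OutputRate.PrefixDependenceOn`, p. 256 / p. 298 in words — so joint
regularity «in the effective coupling constants» (p. 266) is regularity of `v ↦ E (spliceHistory j v h) …`.) [folklore] -/
def spliceHistory (j : ℕ) (v : Fin j → ℝ) (h : ℕ → ℝ) : ℕ → ℝ :=
  fun n => if hn : n < j then v ⟨n, hn⟩ else h n

/-- Below `j` the spliced history is `v`. [cite: Balaban1987RG1, (0.23) p.256 (bookkeeping: the prefix of a coupling history)] -/
theorem spliceHistory_apply_lt {j : ℕ} (v : Fin j → ℝ) (h : ℕ → ℝ) {n : ℕ} (hn : n < j) :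
    spliceHistory j v h n = v ⟨n, hn⟩ := by
  simp [spliceHistory, hn]

/-- On `Fin j` the spliced history is `v`. [cite: Balaban1987RG1, (0.23) p.256 (bookkeeping: the prefix of a coupling history)] -/
@[simp] theorem spliceHistory_apply_fin {j : ℕ} (v : Fin j → ℝ) (h : ℕ → ℝ) (m : Fin j) :
    spliceHistory j v h m = v m := by
  simp [spliceHistory, m.2]

/-- From `j` on the spliced history is `h`. [cite: Balaban1987RG1, (0.23) p.256 (bookkeeping: the prefix of a coupling history)] -/
theorem spliceHistory_apply_ge {j : ℕ} (v : Fin j → ℝ) (h : ℕ → ℝ) {n : ℕ} (hn : j ≤ n) :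
    spliceHistory j v h n = h n := by
  simp [spliceHistory, Nat.not_lt.2 hn]

/-- Splicing a history's own prefix changes nothing. [cite: Balaban1987RG1, (0.23) p.256 (bookkeeping: the prefix of a coupling history)] -/
@[simp] theorem spliceHistory_self (j : ℕ) (h : ℕ → ℝ) : spliceHistory j (fun m : Fin j => h m) h = h := by
  funext n
  by_cases hn : n < j
  · simp [spliceHistory, hn]
  · simp [spliceHistory, hn]

/-- A ONE-COORDINATE SECTION IS A SPLICE: updating coordinate `i < j` of `h` to `s` = splicing the prefix of `h` updated at
`⟨i, _⟩`. [cite: Balaban1987RG1, (0.23) p.256 with p.263 (clause before (1.18)) (bookkeeping: a one-coupling section of the history)] -/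
theorem spliceHistory_update {j : ℕ} (h : ℕ → ℝ) {i : ℕ} (hi : i < j) (s : ℝ) :
    spliceHistory j (Function.update (fun m : Fin j => h m) ⟨i, hi⟩ s) h = Function.update h i s := by
  funext n
  by_cases hn : n < j
  · rw [spliceHistory_apply_lt _ _ hn]
    by_cases hni : n = i
    · subst hni
      simp
    · have hne : (⟨n, hn⟩ : Fin j) ≠ ⟨i, hi⟩ := fun e => hni (by simpa using congrArg Fin.val e)
      rw [Function.update_of_ne hne, Function.update_of_ne hni]
  · have hni : n ≠ i := by omega
    rw [spliceHistory_apply_ge _ _ (Nat.not_lt.1 hn), Function.update_of_ne hni]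

/-- If every coordinate of `h` lies in `I` and `v` lies in the cube `I^j`, the spliced history has all coordinates in `I`
(histories in a box stay in the box). [cite: Balaban1987RG1, Thm 3 p.264 (bookkeeping: the window 0 < g_k ≤ γ of admissible histories)] -/
theorem spliceHistory_mem_boxWindow {I : Set ℝ} {j : ℕ} {v : Fin j → ℝ} {h : ℕ → ℝ}
    (hv : v ∈ Set.pi Set.univ (fun _ : Fin j => I)) (hh : h ∈ BoxWindow I) : spliceHistory j v h ∈ BoxWindow I := by
  intro n
  by_cases hn : n < j
  · rw [spliceHistory_apply_lt _ _ hn]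
    exact hv ⟨n, hn⟩ (Set.mem_univ _)
  · rw [spliceHistory_apply_ge _ _ (Nat.not_lt.1 hn)]
    exact hh n

/-- The one-coordinate insertion `s ↦ p[i := s]` into a prefix vector is real-analytic (coordinatewise constant or the
identity), within any set. [folklore] -/
private theorem analyticOn_update {j : ℕ} (p : Fin j → ℝ) (i : Fin j) (I : Set ℝ) :
    AnalyticOn ℝ (fun s : ℝ => Function.update p i s) I := by
  have : AnalyticOn ℝ (fun s : ℝ => fun m : Fin j => Function.update p i s m) I := by
    refine AnalyticOn.pi fun m => ?_
    by_cases hm : m = i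
    · subst hm
      simp only [Function.update_self]
      exact analyticOn_id
    · simp only [Function.update_of_ne hm]
      exact analyticOn_const
  exact this

/-- … and maps `I` into the cube `I^j` when the other coordinates of `p` lie in `I`. [folklore] -/
private theorem mapsTo_update_pi {j : ℕ} {p : Fin j → ℝ} {I : Set ℝ} (hp : ∀ m, p m ∈ I) (i : Fin j) :
    Set.MapsTo (fun s : ℝ => Function.update p i s) I (Set.pi Set.univ fun _ : Fin j => I) := by
  intro s hs m _
  show Function.update p i s m ∈ I
  by_cases hm : m = i
  · subst hm
    simpa using hs
  · rw [Function.update_of_ne hm]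
    exact hp m

section Clauses

variable {Dom Φ F : Type*} [NormedAddCommGroup F] [NormedSpace ℝ F]

/-! ## §2 [I] p. 263 in history-explicit typing: C^∞ (or analytic) in the LAST coupling, for every frozen older history -/

/-- **[I] p. 263 ll. 22–28, HISTORY-EXPLICIT:** *«It is a C^∞-function of g_{j−1} ∈ [0, γ], (or analytic), with a positive,
absolute γ.»* — for every admissible history `h ∈ W` (the OLDER couplings `g₀, …, g_{j−2}` frozen at their values in `h`; print
p. 256 / p. 298: the term «depends also on all preceding coupling constants»), every localization domain `X` with creation step
`j = scale X ≥ 1` and every configuration `φ` in the space `sp X` (print's `U^c_j(X, α₀, α₁)`), the LAST-coupling section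
`s ↦ E (h[j−1 := s]) φ X` is `C^n` on the coordinate set `I` for every `n` (print: `I = [0, γ]`; one-sided at the endpoints, the
currency `ContDiffOn ℝ n · (Set.Icc 0 γ)` of `Step.SFHyp.betaSmooth` / `B12BetaSmooth.ESmoothAt`).  The Markov-typed form (history
suppressed) is `B12BetaSmooth.ESmoothHyp` / `ESmoothAt`.  A hypothesis schema; asserted nowhere. [cite: Balaban1987RG1, p.263 (clause before (1.18)) with p.256 and p.298] -/
def SmoothInLast263 (W : Set (ℕ → ℝ)) (I : Set ℝ) (scale : Dom → ℕ) (sp : Dom → Set Φ)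
    (E : (ℕ → ℝ) → Φ → Dom → F) : Prop :=
  ∀ (X : Dom) (φ : Φ), φ ∈ sp X → ∀ h ∈ W, ∀ i : ℕ, i + 1 = scale X →
    ∀ n : ℕ, ContDiffOn ℝ n (fun s : ℝ => E (Function.update h i s) φ X) I

/-- **[I] p. 263 «(or analytic)», HISTORY-EXPLICIT** (the alternative the p. 266 sentence explains: *«It has the advantage that
the functions E^{(j)}, β_j are analytic functions of the effective coupling constants»*): for every frozen older history, domain
and configuration in the space, the last-coupling section is real-analytic WITHIN `I` (Mathlib `AnalyticOn ℝ`, the reading of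
`B12BetaSmooth.EAnalyticAt`; print names no complex neighbourhood and no radius).  A hypothesis schema; asserted nowhere.
[cite: Balaban1987RG1, p.263 (clause before (1.18)) with p.266 (paragraph after (2.9))] -/
def AnalyticInLast263 (W : Set (ℕ → ℝ)) (I : Set ℝ) (scale : Dom → ℕ) (sp : Dom → Set Φ)
    (E : (ℕ → ℝ) → Φ → Dom → F) : Prop :=
  ∀ (X : Dom) (φ : Φ), φ ∈ sp X → ∀ h ∈ W, ∀ i : ℕ, i + 1 = scale X →
    AnalyticOn ℝ (fun s : ℝ => E (Function.update h i s) φ X) I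

/-! ## §3 [I] p. 266: «E^{(j)} … are analytic functions of the effective coupling constants» (PLURAL) -/

/-- **[I] p. 266 ll. 33–37, PLURAL, JOINT FORM:** *«Another possibility is to take g_k/γ_kε₁ instead of ε₁, where γ_k =
C log(L^kε)^{−1} with C sufficiently large. It has the advantage that the functions E^{(j)}, β_j are analytic functions of the
effective coupling constants»* — under the ALTERNATIVE small-field cut-off (tree `B12SmallFieldDomain259.chiFluctPrintedAlt`,
`gammaK`), for every history `h ∈ W`, domain `X` (creation step `j = scale X`) and configuration in the space, the map
`(g₀, …, g_{j−1}) ↦ E^{(j)}(X; g₀, …, g_{j−1}; φ)` — i.e. `v ↦ E (spliceHistory j v h) φ X` on `Fin j → ℝ` — is real-analytic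
WITHIN the cube `I^j`.  This is the ONLY printed sentence asserting any regularity of `E^{(j)}` in the OLDER couplings
`g₀, …, g_{j−2}`; it carries no radius, no bound and no uniformity (HONEST SCOPE (ii)–(iv)).  A hypothesis schema; asserted
nowhere. [cite: Balaban1987RG1, p.266 (paragraph after (2.9)) with p.256] -/
def AnalyticInCouplings266 (W : Set (ℕ → ℝ)) (I : Set ℝ) (scale : Dom → ℕ) (sp : Dom → Set Φ)
    (E : (ℕ → ℝ) → Φ → Dom → F) : Prop :=
  ∀ (X : Dom) (φ : Φ), φ ∈ sp X → ∀ h ∈ W,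
    AnalyticOn ℝ (fun v : Fin (scale X) → ℝ => E (spliceHistory (scale X) v h) φ X) (Set.pi Set.univ fun _ => I)

/-- **[I] p. 266, PLURAL, COORDINATEWISE FORM:** every YOUNG-COUPLING SECTION `s ↦ E (h[i := s]) φ X`, `i < scale X`, of the
scale-`j` term is real-analytic within `I`, for every frozen history `h ∈ W` and configuration in the space — the printed TYPE
behind the N22 road-3 slots «(A) / (A′) in EACH young coupling» (which add an unprinted uniform radius and derivative letter).
Follows from the joint form (`analyticInEachCoupling266_of_analyticInCouplings266`); its `i = j − 1` instance is p. 263's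
«(or analytic)» (`analyticInLast263_of_each`).  A hypothesis schema; asserted nowhere.
[cite: Balaban1987RG1, p.266 (paragraph after (2.9)) with p.263 (clause before (1.18))] -/
def AnalyticInEachCoupling266 (W : Set (ℕ → ℝ)) (I : Set ℝ) (scale : Dom → ℕ) (sp : Dom → Set Φ)
    (E : (ℕ → ℝ) → Φ → Dom → F) : Prop :=
  ∀ (X : Dom) (φ : Φ), φ ∈ sp X → ∀ h ∈ W, ∀ i : ℕ, i < scale X →
    AnalyticOn ℝ (fun s : ℝ => E (Function.update h i s) φ X) I

/-- The `C^∞` shadow of the p. 266 sentence, coordinatewise: every young-coupling section is `C^n` on `I` for every `n` — p. 263's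
C^∞ clause extended from the last coupling to all preceding ones, which print asserts ONLY through the analytic alternative of
p. 266 (`smoothInEachCoupling266_of_analytic`); for the last coupling alone it is `SmoothInLast263`.  A hypothesis schema;
asserted nowhere. [cite: Balaban1987RG1, p.266 (paragraph after (2.9)) with p.263 (clause before (1.18))] -/
def SmoothInEachCoupling266 (W : Set (ℕ → ℝ)) (I : Set ℝ) (scale : Dom → ℕ) (sp : Dom → Set Φ)
    (E : (ℕ → ℝ) → Φ → Dom → F) : Prop :=
  ∀ (X : Dom) (φ : Φ), φ ∈ sp X → ∀ h ∈ W, ∀ i : ℕ, i < scale X →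
    ∀ n : ℕ, ContDiffOn ℝ n (fun s : ℝ => E (Function.update h i s) φ X) I

variable {W : Set (ℕ → ℝ)} {I : Set ℝ} {scale : Dom → ℕ} {sp : Dom → Set Φ} {E : (ℕ → ℝ) → Φ → Dom → F}

/-- **Joint ⇒ coordinatewise** (p. 266 plural ⇒ each young-coupling section analytic): compose the joint map with the analytic
insertion `s ↦ (prefix of h)[i := s]`, which maps `I` into the cube when the history's coordinates lie in `I` (`hW`; e.g.
`W = BoxWindow I`, or `W = T4OutputRate.Window γ` with `I = [0, γ]`). [cite: Balaban1987RG1, p.266 (paragraph after (2.9)) with p.263 (clause before (1.18)) (bookkeeping: joint ⇒ coordinatewise)] -/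
theorem analyticInEachCoupling266_of_analyticInCouplings266 (hW : ∀ h ∈ W, ∀ n, h n ∈ I)
    (hA : AnalyticInCouplings266 W I scale sp E) : AnalyticInEachCoupling266 W I scale sp E := by
  intro X φ hφ h hh i hi
  have hjoint := hA X φ hφ h hh
  set p : Fin (scale X) → ℝ := fun m => h m with hp
  have hins : AnalyticOn ℝ (fun s : ℝ => Function.update p ⟨i, hi⟩ s) I := analyticOn_update p ⟨i, hi⟩ I
  have hmaps : Set.MapsTo (fun s : ℝ => Function.update p ⟨i, hi⟩ s) I (Set.pi Set.univ fun _ : Fin (scale X) => I) :=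
    mapsTo_update_pi (fun m => hW h hh m) ⟨i, hi⟩
  have hcomp := hjoint.comp hins hmaps
  refine hcomp.congr fun s _ => ?_
  simp only [Function.comp_apply]
  rw [hp, spliceHistory_update h hi s]

/-- THE PRINTED INSTANCE of the previous link: histories in the window `]0, γ]^ℕ` of Theorems 1 / 3 (`T4OutputRate.Window γ`),
regularity variable on p. 263's CLOSED interval `[0, γ]` — every window history has its coordinates in `[0, γ]`, so p. 266's joint
form gives every young-coupling section analytic within `[0, γ]`.
[cite: Balaban1987RG1, p.266 (paragraph after (2.9)) with p.263 (clause before (1.18)) and Thm 3 p.264 (bookkeeping)] -/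
theorem analyticInEachCoupling266_window_of_couplings {γ : ℝ}
    (hA : AnalyticInCouplings266 (Window γ) (Set.Icc 0 γ) scale sp E) :
    AnalyticInEachCoupling266 (Window γ) (Set.Icc 0 γ) scale sp E :=
  analyticInEachCoupling266_of_analyticInCouplings266 (fun _ hh n => ⟨(hh n).1.le, (hh n).2⟩) hA

/-- The last coupling is a young coupling: p. 266 coordinatewise ⇒ p. 263 «(or analytic)» in history-explicit form. [cite: Balaban1987RG1, p.263 (clause before (1.18)) with p.266 (paragraph after (2.9)) (bookkeeping)] -/
theorem analyticInLast263_of_each (hA : AnalyticInEachCoupling266 W I scale sp E) : AnalyticInLast263 W I scale sp E :=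
  fun X φ hφ h hh i hi => hA X φ hφ h hh i (by omega)

/-- p. 266 coordinatewise C^∞ ⇒ p. 263 C^∞ in history-explicit form. [cite: Balaban1987RG1, p.263 (clause before (1.18)) with p.266 (paragraph after (2.9)) (bookkeeping)] -/
theorem smoothInLast263_of_each (hS : SmoothInEachCoupling266 W I scale sp E) : SmoothInLast263 W I scale sp E :=
  fun X φ hφ h hh i hi => hS X φ hφ h hh i (by omega)

/-- «(or analytic)» ⇒ «C^∞», every young coupling (values in a complete space, e.g. `ℝ`, `ℂ`; Mathlib
`AnalyticOn.contDiffOn_of_completeSpace` — within-set analyticity gives `ContDiffOn ℝ n` for every `n`). [cite: Balaban1987RG1, p.266 (paragraph after (2.9)) with p.263 (clause before (1.18)) (bookkeeping: «(or analytic)» ⇒ «C^∞»)] -/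
theorem smoothInEachCoupling266_of_analytic [CompleteSpace F] (hA : AnalyticInEachCoupling266 W I scale sp E) :
    SmoothInEachCoupling266 W I scale sp E :=
  fun X φ hφ h hh i hi _ => (hA X φ hφ h hh i hi).contDiffOn_of_completeSpace

/-- «(or analytic)» ⇒ «C^∞» for the last coupling (the history-explicit twin of `B12BetaSmooth.eSmoothAt_of_analytic`). [cite: Balaban1987RG1, p.263 (clause before (1.18)) (bookkeeping: «(or analytic)» ⇒ «C^∞»)] -/
theorem smoothInLast263_of_analytic [CompleteSpace F] (hA : AnalyticInLast263 W I scale sp E) :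
    SmoothInLast263 W I scale sp E :=
  fun X φ hφ h hh i hi _ => (hA X φ hφ h hh i hi).contDiffOn_of_completeSpace

/-- C^∞ sections are continuous sections (order `0`). [cite: Balaban1987RG1, p.263 (clause before (1.18)) with p.266 (paragraph after (2.9)) (bookkeeping)] -/
theorem continuousOn_section_of_smoothInEachCoupling266 (hS : SmoothInEachCoupling266 W I scale sp E) {X : Dom} {φ : Φ}
    (hφ : φ ∈ sp X) {h : ℕ → ℝ} (hh : h ∈ W) {i : ℕ} (hi : i < scale X) :
    ContinuousOn (fun s : ℝ => E (Function.update h i s) φ X) I :=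
  (hS X φ hφ h hh i hi 0).continuousOn

/-- Monotonicity in the history set and the space table (fewer histories / smaller spaces ⇒ weaker clause). [cite: Balaban1987RG1, p.266 (paragraph after (2.9)) (bookkeeping: monotonicity of the schema)] -/
theorem analyticInEachCoupling266_mono {W' : Set (ℕ → ℝ)} {sp' : Dom → Set Φ} (hW : W' ⊆ W) (hsp : ∀ X, sp' X ⊆ sp X)
    (hA : AnalyticInEachCoupling266 W I scale sp E) : AnalyticInEachCoupling266 W' I scale sp' E :=
  fun X φ hφ h hh i hi => hA X φ (hsp X hφ) h (hW hh) i hi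

/-- Monotonicity in the coordinate set (analytic within `I` ⇒ analytic within `I′ ⊆ I`). [cite: Balaban1987RG1, p.266 (paragraph after (2.9)) (bookkeeping: monotonicity of the schema)] -/
theorem analyticInEachCoupling266_mono_set {I' : Set ℝ} (hI : I' ⊆ I) (hA : AnalyticInEachCoupling266 W I scale sp E) :
    AnalyticInEachCoupling266 W I' scale sp E :=
  fun X φ hφ h hh i hi => (hA X φ hφ h hh i hi).mono hI

end Clauses

/-! ## §4 The direction of the cell's quantitative shapes: complex extension ⇒ the printed type -/

/-- A real function that agrees, on `I` near `s ∈ I`, with a function `F : ℂ → ℂ` complex-differentiable on a NEIGHBOURHOOD of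
`s` is real-analytic within `I` at `s` (holomorphic ⇒ analytic ⇒ restrict scalars ⇒ compose with `ℝ ↪ ℂ` and `Re`). [folklore] -/
private theorem analyticWithinAt_of_complexExtension {f : ℝ → ℝ} {I : Set ℝ} {s : ℝ} (hs : s ∈ I) (F : ℂ → ℂ) (D : Set ℂ)
    (hD : D ∈ 𝓝 (s : ℂ)) (hF : DifferentiableOn ℂ F D) (hEq : ∀ t ∈ I, (t : ℂ) ∈ D → F t = (f t : ℂ)) :
    AnalyticWithinAt ℝ f I s := by
  obtain ⟨U, hUD, hUo, hsU⟩ := _root_.mem_nhds_iff.1 hD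
  have hFa : AnalyticAt ℂ F (s : ℂ) := (hF.mono hUD).analyticAt (hUo.mem_nhds hsU)
  have h1 : AnalyticAt ℝ F (s : ℂ) := hFa.restrictScalars
  have h2 : AnalyticAt ℝ (fun t : ℝ => F t) s := h1.comp (Complex.ofRealCLM.analyticAt s)
  have h3 : AnalyticAt ℝ (fun t : ℝ => (F t).re) s := (Complex.reCLM.analyticAt _).comp h2
  -- near `s`, within `I`, the real trace of `F` is `f`
  have hV : ∀ᶠ t in 𝓝[I] s, (fun t : ℝ => (F t).re) t = f t := by
    have hpre : ∀ᶠ t in 𝓝 s, ((t : ℝ) : ℂ) ∈ U :=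
      Complex.continuous_ofReal.continuousAt.preimage_mem_nhds (hUo.mem_nhds hsU)
    filter_upwards [mem_nhdsWithin_of_mem_nhds hpre, self_mem_nhdsWithin] with t htU htI
    rw [hEq t htI (hUD htU), Complex.ofReal_re]
  have hsEq : (fun t : ℝ => (F t).re) s = f s := by
    simp only
    rw [hEq s hs (hUD hsU), Complex.ofReal_re]
  exact h3.analyticWithinAt.congr_of_eventuallyEq (hV.mono fun t ht => ht.symm) hsEq.symm

/-- … hence a real function with such an extension about EVERY point of `I` is real-analytic within `I`. [folklore] -/
private theorem analyticOn_of_complexExtension {f : ℝ → ℝ} {I : Set ℝ}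
    (h : ∀ s ∈ I, ∃ (F : ℂ → ℂ) (D : Set ℂ), D ∈ 𝓝 (s : ℂ) ∧ DifferentiableOn ℂ F D ∧
      ∀ t ∈ I, (t : ℂ) ∈ D → F t = (f t : ℂ)) :
    AnalyticOn ℝ f I := by
  intro s hs
  obtain ⟨F, D, hD, hF, hEq⟩ := h s hs
  exact analyticWithinAt_of_complexExtension hs F D hD hF hEq

variable {C : Carriers} {Bg : Type}

/-- **The cell's (A)-shape implies the printed type.**  `T4CouplingAnalyticity.CouplingAnalyticOn I E κ M r` (coordinate-disc
analyticity with CLOSED discs of radius `r j i` about the points of `I` and a sup bound — NOT PRINTED) with positive radii gives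
`AnalyticInEachCoupling266 (BoxWindow I) I C.scale (fun _ => univ) E`: the typed road-3 input of N22 is a STRENGTHENING of what
p. 263 / p. 266 print, not a different statement.  (The converse — radius, bound, uniformity — is NE9's unprinted content.)
[cite: Balaban1987RG1, p.266 (paragraph after (2.9)) with p.263 (clause before (1.18))] -/
theorem analyticInEachCoupling266_of_couplingAnalyticOn {I : Set ℝ} {E : Functional C Bg} {κ M : ℝ} {r : ℕ → ℕ → ℝ}
    (hr : ∀ j i, i < j → 0 < r j i) (hA : CouplingAnalyticOn I E κ M r) :
    AnalyticInEachCoupling266 (BoxWindow I) I C.scale (fun _ => (Set.univ : Set Bg)) E := by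
  intro X U _ h hh i hi
  obtain ⟨F, D, hF, -, hball, hEq⟩ := hA U X h hh i hi
  refine analyticOn_of_complexExtension fun s hs => ⟨F, D, ?_, hF, fun t ht _ => hEq t ht⟩
  exact Filter.mem_of_superset (closedBall_mem_nhds _ (hr _ _ hi)) (hball s hs)

/-- **The (A′) open-disc / derivative-letter currency implies the printed type as well**: if every young-coupling section over the
window `]0, γ]` has a complex-differentiable extension on a set containing the OPEN `r`-discs (`r > 0`) about the points of
`]0, γ]` (the `hA` clause of `Summits/…/BalabanUVNodesN22AtRecordStrip.n22At_of_oscStrip`, its letter dropped), then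
`AnalyticInEachCoupling266 (Window γ) (Ioc 0 γ) C.scale (fun _ => univ) E`. [cite: Balaban1987RG1, p.266 (paragraph after (2.9)) with p.263 (clause before (1.18))] -/
theorem analyticInEachCoupling266_of_openDiscs {γ r : ℝ} {E : Functional C Bg} (hr : 0 < r)
    (hA : ∀ g ∈ Window γ, ∀ (U : Bg) (X : C.Dom) (i : ℕ), i < C.scale X → ∃ (F : ℂ → ℂ) (Dset : Set ℂ),
      DifferentiableOn ℂ F Dset ∧ (∀ t ∈ Ioc (0 : ℝ) γ, ball (t : ℂ) r ⊆ Dset) ∧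
      (∀ t ∈ Ioc (0 : ℝ) γ, F t = (E (Function.update g i t) U X : ℂ))) :
    AnalyticInEachCoupling266 (Window γ) (Ioc 0 γ) C.scale (fun _ => (Set.univ : Set Bg)) E := by
  intro X U _ g hg i hi
  obtain ⟨F, D, hF, hball, hEq⟩ := hA g hg U X i hi
  refine analyticOn_of_complexExtension fun s hs => ⟨F, D, ?_, hF, fun t ht _ => hEq t ht⟩
  exact Filter.mem_of_superset (ball_mem_nhds _ hr) (hball s hs)

/-- Over `T4OutputRate.Functional` the printed window and interval read: histories in `Window γ = BoxWindow ]0, γ]`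
(`T4CouplingAnalyticity.window_eq_boxWindow`), sections on `]0, γ]`; the p. 263 reading with the CLOSED interval is the instance
`I = [0, γ]` (histories still in the window, the section variable allowed to reach `0`).  Recorded as the unfolding of the
coordinatewise schema at `sp = univ`. [cite: Balaban1987RG1, p.266 (paragraph after (2.9)) with Thm 1 p.259 (bookkeeping: unfolding over `T4OutputRate.Functional`)] -/
theorem analyticInEachCoupling266_functional_iff {W : Set (ℕ → ℝ)} {I : Set ℝ} {E : Functional C Bg} :
    AnalyticInEachCoupling266 W I C.scale (fun _ => (Set.univ : Set Bg)) E ↔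
      ∀ (X : C.Dom) (U : Bg), ∀ h ∈ W, ∀ i < C.scale X, AnalyticOn ℝ (fun s : ℝ => E (Function.update h i s) U X) I :=
  ⟨fun hA X U h hh i hi => hA X U (Set.mem_univ _) h hh i hi, fun hA X U _ h hh i hi => hA X U h hh i hi⟩

/-! ## §5 β-side, history typing `FlowStep.HBeta` ([I] p. 264 β-clause, p. 298, p. 266 plural) -/

/-- **[I] p. 264 ll. 25–27, HISTORY-EXPLICIT:** of `β_{j+1}(g_j)` — *«It is a smooth function defined on the interval [0, γ], (or
analytic)»* — with p. 298: *«We write β_j as explicitly dependent on g_{j−1} although it depends also on all preceding coupling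
constants»*: for every scale `k` and every frozen history `p = (g₀, …, g_k) ∈ ]0, γ]^{k+1}` (`FlowStep.Box γ k`), the LAST-variable
section `s ↦ β k (p[last := s]) = β_{k+1}(g₀, …, g_{k−1}, s)` is `C^n` on `[0, γ]` for every `n`.  The Markov-typed form is
`Step.SFHyp.betaSmooth` / `B12StepObligation.BetaSmoothAt` (`betaSmoothInLast264_ofMarkov_iff`).  A hypothesis schema; asserted
nowhere (and PROVED nowhere in [I] §§2–5 or [II]: cell GAPS G-adv2-3, G-adv2-6). [cite: Balaban1987RG1, p.264 (β-clause after (1.22)) with p.298] -/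
def BetaSmoothInLast264 (γ : ℝ) (β : HBeta) : Prop :=
  ∀ (k : ℕ) (p : Fin (k + 1) → ℝ), p ∈ Box γ k →
    ∀ n : ℕ, ContDiffOn ℝ n (fun s : ℝ => β k (Function.update p (Fin.last k) s)) (Set.Icc 0 γ)

/-- **[I] p. 264 «(or analytic)», HISTORY-EXPLICIT:** for every scale and frozen history, the last-variable section of `β_{k+1}` is
real-analytic within `[0, γ]` (the reading of `B12BetaSmooth.BetaAnalyticAt`).  A hypothesis schema; asserted nowhere.
[cite: Balaban1987RG1, p.264 (β-clause after (1.22)) with p.266 (paragraph after (2.9)) and p.298] -/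
def BetaAnalyticInLast264 (γ : ℝ) (β : HBeta) : Prop :=
  ∀ (k : ℕ) (p : Fin (k + 1) → ℝ), p ∈ Box γ k →
    AnalyticOn ℝ (fun s : ℝ => β k (Function.update p (Fin.last k) s)) (Set.Icc 0 γ)

/-- **[I] p. 264 «uniformly bounded on this interval together with all derivatives», WEAKEST READING, HISTORY-EXPLICIT:** for
every scale `k`, frozen history `p ∈ ]0, γ]^{k+1}` and order `n` there is ONE bound `B` with
`‖∂ⁿ_s β_{k+1}(g₀, …, g_{k−1}, s)‖ ≤ B` for all `s ∈ [0, γ]` (derivatives within `[0, γ]`) — «uniformly» read as uniformity IN THE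
INTERVAL only.  Print does not DECIDE between this per-scale reading and the j- and history-UNIFORM one (§6
`BetaDerivsUniformInLast264`: ONE table of constants for all scales and histories): the sentence sits among §1's inductive
assumptions, whose constants are «absolute», «independent of X and j» (p. 263), so the uniform reading is at least as printable
(referee reading note D-g113-1, `lit-balaban-ref-4`, on v1); this schema takes the weakest, under which the clause adds nothing to
smoothness (`betaDerivsBoundedInLast264_of_smooth`).  The cell's k- and history-uniform first-order form is
`BetaDerivClause.LastVarDerivBound` (fed from §6 by `lastVarDerivBound_of_uniform`), the Markov per-step form with a constants table
`B12BetaSmooth.BetaDerivBoundsAt`.  A hypothesis schema; asserted nowhere; no constants and no proof are printed in [I] §§2–5 or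
[II] (GAPS G-adv2-3 (b), G-b12-2). [cite: Balaban1987RG1, p.264 (β-clause after (1.22)) with p.298] -/
def BetaDerivsBoundedInLast264 (γ : ℝ) (β : HBeta) : Prop :=
  ∀ (k : ℕ) (p : Fin (k + 1) → ℝ), p ∈ Box γ k → ∀ n : ℕ, ∃ B : ℝ, ∀ s ∈ Set.Icc (0 : ℝ) γ,
    ‖iteratedDerivWithin n (fun s' : ℝ => β k (Function.update p (Fin.last k) s')) (Set.Icc 0 γ) s‖ ≤ B

/-- **[I] p. 266, β-SIDE, PLURAL:** *«the functions E^{(j)}, β_j are analytic functions of the effective coupling constants»* (under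
the alternative cut-off `g_k/γ_kε₁`): every `β k = β_{k+1}(g₀, …, g_k)` is JOINTLY real-analytic within the closed cube
`[0, γ]^{k+1}` (the cube of p. 264's interval; `FlowStep.Box γ k = ]0, γ]^{k+1} ⊆` it).  The only printed regularity of `β_{k+1}` in
the OLDER couplings; no radius, no bound.  A hypothesis schema; asserted nowhere. [cite: Balaban1987RG1, p.266 (paragraph after (2.9)) with p.264 and p.298] -/
def BetaAnalyticInCouplings266 (γ : ℝ) (β : HBeta) : Prop :=
  ∀ k : ℕ, AnalyticOn ℝ (β k) (Set.pi Set.univ fun _ : Fin (k + 1) => Set.Icc 0 γ)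

/-- The box `]0, γ]^{k+1}` of `FlowStep` lies in the closed cube `[0, γ]^{k+1}`. [folklore] -/
private theorem box_subset_IccCube (γ : ℝ) (k : ℕ) : Box γ k ⊆ Set.pi Set.univ (fun _ : Fin (k + 1) => Set.Icc 0 γ) := by
  intro p hp m _
  have := (mem_box.1 hp) m
  exact ⟨this.1.le, this.2⟩

/-- «(or analytic)» ⇒ «smooth» in the last variable, history-explicit (`γ > 0` makes `[0, γ]` a set of unique differentiability;
the twin of `B12BetaSmooth.betaSmoothAt_of_analytic`). [cite: Balaban1987RG1, p.264 (β-clause after (1.22)) (bookkeeping: «(or analytic)» ⇒ «smooth»)] -/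
theorem betaSmoothInLast264_of_analytic {γ : ℝ} {β : HBeta} (hγ : 0 < γ) (hA : BetaAnalyticInLast264 γ β) :
    BetaSmoothInLast264 γ β :=
  fun k p hp _ => (hA k p hp).contDiffOn (uniqueDiffOn_Icc hγ)

/-- **p. 266 plural ⇒ p. 264 «(or analytic)» in the last variable:** restrict the jointly analytic `β k` along the analytic insertion
`s ↦ p[last := s]`, which maps `[0, γ]` into the cube for `p ∈ ]0, γ]^{k+1}`. [cite: Balaban1987RG1, p.266 (paragraph after (2.9)) with p.264 (β-clause after (1.22)) (bookkeeping: joint ⇒ last variable)] -/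
theorem betaAnalyticInLast264_of_couplings {γ : ℝ} {β : HBeta} (hA : BetaAnalyticInCouplings266 γ β) :
    BetaAnalyticInLast264 γ β := by
  intro k p hp
  have hins : AnalyticOn ℝ (fun s : ℝ => Function.update p (Fin.last k) s) (Set.Icc 0 γ) :=
    analyticOn_update p (Fin.last k) _
  have hmaps : Set.MapsTo (fun s : ℝ => Function.update p (Fin.last k) s) (Set.Icc 0 γ)
      (Set.pi Set.univ fun _ : Fin (k + 1) => Set.Icc 0 γ) :=
    mapsTo_update_pi (fun m => box_subset_IccCube γ k hp m (Set.mem_univ _)) (Fin.last k)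
  exact (hA k).comp hins hmaps

/-- **p. 266 plural ⇒ the tree's joint-continuity binder `FlowStep.BetaContH`** (continuity of each `β_{k+1}` on `]0, γ]^{k+1}`, the
input of Theorem 2's forward shooting `FlowStep.continuousOn_Y`; `BetaDerivClause`'s header: «not even ASSERTED in print for the
earlier variables» — under the p. 266 alternative it is, qualitatively). [cite: Balaban1987RG1, p.266 (paragraph after (2.9)) with p.264 (β-clause after (1.22)) (bookkeeping: analytic ⇒ continuous on the box)] -/
theorem betaContH_of_analyticInCouplings266 {γ : ℝ} {β : HBeta} (hA : BetaAnalyticInCouplings266 γ β) : BetaContH γ β :=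
  fun k => ((hA k).continuousOn).mono (box_subset_IccCube γ k)

/-- Smooth sections are continuous sections: `BetaSmoothInLast264` gives continuity of every last-variable section on `[0, γ]`
(order `0`). [cite: Balaban1987RG1, p.264 (β-clause after (1.22)) (bookkeeping)] -/
theorem continuousOn_lastSection_of_betaSmoothInLast264 {γ : ℝ} {β : HBeta} (hS : BetaSmoothInLast264 γ β) (k : ℕ)
    {p : Fin (k + 1) → ℝ} (hp : p ∈ Box γ k) :
    ContinuousOn (fun s : ℝ => β k (Function.update p (Fin.last k) s)) (Set.Icc 0 γ) :=
  (hS k p hp 0).continuousOn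

/-- A smooth last-variable section on the COMPACT interval has all its derivatives bounded there — so `BetaSmoothInLast264`
already yields the VERBATIM reading `BetaDerivsBoundedInLast264` (per scale, per history, per order: continuity of
`iteratedDerivWithin n` on `[0, γ]`, `γ > 0`); what print's sentence adds beyond smoothness is therefore only the (unprinted)
uniformity discussed in that schema's docstring. [cite: Balaban1987RG1, p.264 (β-clause after (1.22)) (bookkeeping: smooth on the compact interval ⇒ bounded derivatives)] -/
theorem betaDerivsBoundedInLast264_of_smooth {γ : ℝ} {β : HBeta} (hγ : 0 < γ) (hS : BetaSmoothInLast264 γ β) :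
    BetaDerivsBoundedInLast264 γ β := by
  intro k p hp n
  have hcont : ContinuousOn
      (iteratedDerivWithin n (fun s' : ℝ => β k (Function.update p (Fin.last k) s')) (Set.Icc 0 γ)) (Set.Icc 0 γ) :=
    (hS k p hp (n + 1)).continuousOn_iteratedDerivWithin (by exact_mod_cast Nat.le_succ n) (uniqueDiffOn_Icc hγ)
  obtain ⟨B, hB⟩ := (isCompact_Icc.image_of_continuousOn hcont).isBounded.exists_norm_le
  exact ⟨B, fun s hs => hB _ (Set.mem_image_of_mem _ hs)⟩

/-- **Markov bridge:** for a Markovian family `FlowStep.ofMarkov βM` (`β_{k+1}` a function of `g_k` alone, (0.18)/(0.20) p. 255–256)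
the history-explicit clause IS the Markov one: `BetaSmoothInLast264 γ (ofMarkov βM) ↔ ∀ k n, ContDiffOn ℝ n (βM (k+1)) [0, γ]`
(`γ > 0`, so that every box is inhabited) — the currency of `Step.SFHyp.betaSmooth` / `B12StepObligation.BetaSmoothAt`. [cite: Balaban1987RG1, p.264 (β-clause after (1.22)) with (0.20) p.256 (bookkeeping: the Markov reading)] -/
theorem betaSmoothInLast264_ofMarkov_iff {γ : ℝ} (hγ : 0 < γ) (βM : ℕ → ℝ → ℝ) :
    BetaSmoothInLast264 γ (ofMarkov βM) ↔ ∀ k n : ℕ, ContDiffOn ℝ n (βM (k + 1)) (Set.Icc 0 γ) := by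
  have key : ∀ (k : ℕ) (p : Fin (k + 1) → ℝ),
      (fun s : ℝ => ofMarkov βM k (Function.update p (Fin.last k) s)) = βM (k + 1) := by
    intro k p
    funext s
    simp [ofMarkov]
  constructor
  · intro h k n
    have hp : (fun _ : Fin (k + 1) => γ) ∈ Box γ k := mem_box.2 fun _ => ⟨hγ, le_rfl⟩
    have := h k _ hp n
    rwa [key] at this
  · intro h k p _ n
    rw [key]
    exact h k n

/-! ## §6 (v1.1) p. 264 «uniformly bounded … together with all derivatives» — the j- and history-UNIFORM reading -/

/-- **[I] p. 264 «uniformly bounded on this interval together with all derivatives», j- AND history-UNIFORM all-orders READING,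
HISTORY-EXPLICIT:** ONE table of constants `b : ℕ → ℝ` such that for every order `n`, every scale `k`, every frozen history
`p = (g₀, …, g_k) ∈ ]0, γ]^{k+1}` (`FlowStep.Box γ k`) and every `s ∈ [0, γ]`,
`‖∂ⁿ_s β_{k+1}(g₀, …, g_{k−1}, s)‖ ≤ b n` (derivatives within `[0, γ]`).  The reading in which the constants, like all constants
of §1's inductive assumptions, are «absolute» (p. 263: «constants independent of X and j»; Theorem 3 p. 264: one `γ` for
`k = 0, 1, …, K`); print does not DECIDE between it and §5's per-scale `BetaDerivsBoundedInLast264` (referee reading note D-g113-1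
on v1) — both are typed, this one is the stronger.  Order 0 is the tree's `FlowStep.BetaUpperH` / `BetaLowerH` (two-sided), order 1
the cell's `BetaDerivClause.LastVarDerivBound` (bridges below).  A hypothesis schema; asserted nowhere; NO value of any `b n` and
no proof are printed in [I] §§2–5 or [II] (GAPS G-adv2-3 (b), G-b12-2; p. 264: «We will investigate other properties in a
separate paper»). [cite: Balaban1987RG1, p.264 (β-clause after (1.22)) with p.263 (clause before (1.18): «absolute constants») and p.298] -/
def BetaDerivsUniformInLast264 (γ : ℝ) (β : HBeta) (b : ℕ → ℝ) : Prop :=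
  ∀ (n k : ℕ) (p : Fin (k + 1) → ℝ), p ∈ Box γ k → ∀ s ∈ Set.Icc (0 : ℝ) γ,
    ‖iteratedDerivWithin n (fun s' : ℝ => β k (Function.update p (Fin.last k) s')) (Set.Icc 0 γ) s‖ ≤ b n

/-- Uniform ⇒ weakest: the j- and history-uniform reading implies §5's per-scale reading (bound `b n` at every scale and
history). [cite: Balaban1987RG1, p.264 (β-clause after (1.22)) (bookkeeping: the two readings compared)] -/
theorem betaDerivsBoundedInLast264_of_uniform {γ : ℝ} {β : HBeta} {b : ℕ → ℝ} (h : BetaDerivsUniformInLast264 γ β b) :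
    BetaDerivsBoundedInLast264 γ β :=
  fun k p hp n => ⟨b n, fun s hs => h n k p hp s hs⟩

/-- Monotonicity in the table: larger constants give a weaker clause. [cite: Balaban1987RG1, p.264 (β-clause after (1.22)) (bookkeeping: monotonicity of the schema)] -/
theorem betaDerivsUniformInLast264_mono {γ : ℝ} {β : HBeta} {b b' : ℕ → ℝ} (hbb' : ∀ n, b n ≤ b' n)
    (h : BetaDerivsUniformInLast264 γ β b) : BetaDerivsUniformInLast264 γ β b' :=
  fun n k p hp s hs => (h n k p hp s hs).trans (hbb' n)

/-- **Order 0, on the diagonal:** the uniform reading bounds `β_{k+1}` itself on every box, `|β k p| ≤ b 0` for `p ∈ ]0, γ]^{k+1}`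
(read the section of `p` at its own last coordinate `s = g_k ∈ ]0, γ] ⊆ [0, γ]`). [cite: Balaban1987RG1, p.264 (β-clause after (1.22): «uniformly bounded on this interval») (bookkeeping: order 0)] -/
theorem abs_le_of_uniform {γ : ℝ} {β : HBeta} {b : ℕ → ℝ} (h : BetaDerivsUniformInLast264 γ β b) (k : ℕ)
    {p : Fin (k + 1) → ℝ} (hp : p ∈ Box γ k) : |β k p| ≤ b 0 := by
  have hlast : p (Fin.last k) ∈ Set.Icc (0 : ℝ) γ :=
    ⟨((mem_box.1 hp) (Fin.last k)).1.le, ((mem_box.1 hp) (Fin.last k)).2⟩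
  have := h 0 k p hp (p (Fin.last k)) hlast
  simpa [iteratedDerivWithin_zero, Function.update_eq_self, Real.norm_eq_abs] using this

/-- **Order 0 ⇒ the tree's flow input `FlowStep.BetaUpperH (b 0) γ β`** (`β_{k+1} ≤ b 0` on every box — the binder `FlowStep`'s
header reads off the same p. 264 words «uniformly bounded», i.e. in the uniform reading). [cite: Balaban1987RG1, p.264 (β-clause after (1.22)) (bookkeeping: order 0 ⇒ `BetaUpperH`)] -/
theorem betaUpperH_of_uniform {γ : ℝ} {β : HBeta} {b : ℕ → ℝ} (h : BetaDerivsUniformInLast264 γ β b) :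
    BetaUpperH (b 0) γ β :=
  fun k _ hv => (le_abs_self _).trans (abs_le_of_uniform h k hv)

/-- **Order 0 ⇒ `FlowStep.BetaLowerH (−b 0) γ β`** (the two-sided content of «bounded»; NOT the sign / asymptotic-freedom lower
bounds `BetaSignH` / `BetaAFH`, which print does not assert). [cite: Balaban1987RG1, p.264 (β-clause after (1.22)) (bookkeeping: order 0, lower side)] -/
theorem betaLowerH_of_uniform {γ : ℝ} {β : HBeta} {b : ℕ → ℝ} (h : BetaDerivsUniformInLast264 γ β b) :
    BetaLowerH (-b 0) γ β :=
  fun k _ hv => (neg_le_neg (abs_le_of_uniform h k hv)).trans (neg_abs_le _)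

/-- **Order 1 (with the smoothness clause) ⇒ the cell's `BetaDerivClause.LastVarDerivBound β (b 1) γ`:** every last-variable
section is differentiable within `[0, γ]` (from `BetaSmoothInLast264`, order ≥ 1) with derivative `derivWithin`, and
`|derivWithin| = ‖iteratedDerivWithin 1‖ ≤ b 1`.  `BetaDerivClause`'s header calls the k- and history-uniformity of this
hypothesis unprinted; in the UNIFORM reading of p. 264 (and only in it) this is its printed provenance.  (`B12Beta.HistBox = FlowStep.Box`,
`FlowStep.histBox_eq_box`.) [cite: Balaban1987RG1, p.264 (β-clause after (1.22)) (bookkeeping: order 1 ⇒ `LastVarDerivBound`)] -/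
theorem lastVarDerivBound_of_uniform {γ : ℝ} {β : HBeta} {b : ℕ → ℝ} (hS : BetaSmoothInLast264 γ β)
    (h : BetaDerivsUniformInLast264 γ β b) : BetaDerivClause.LastVarDerivBound β (b 1) γ := by
  intro k p hp
  rw [histBox_eq_box] at hp
  have hdiff : DifferentiableOn ℝ (fun g : ℝ => β k (Function.update p (Fin.last k) g)) (Set.Icc 0 γ) :=
    (hS k p hp 1).differentiableOn one_ne_zero
  refine ⟨derivWithin (fun g : ℝ => β k (Function.update p (Fin.last k) g)) (Set.Icc 0 γ),
    fun g hg => (hdiff g hg).hasDerivWithinAt, fun g hg => ?_⟩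
  have := h 1 k p hp g hg
  rwa [iteratedDerivWithin_one, Real.norm_eq_abs] at this

/-- **Order 1 ⇒ `BetaDerivClause.LastVarLipschitz β (b 1) γ`** (mean value on the convex `[0, γ]`, via the cell's
`BetaDerivClause.lastVarLipschitz_of_derivBound`): `|β_{k+1}(…, t) − β_{k+1}(…, s)| ≤ b 1 · |t − s|`, one constant for all scales and
histories — the input of `BetaDerivClause`'s (AF-1) chain `atZero_of_lastVarLipschitz` / `af1_of_lastVarLipschitz`. [cite: Balaban1987RG1, p.264 (β-clause after (1.22)) (bookkeeping: order 1 ⇒ Lipschitz in the last variable)] -/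
theorem lastVarLipschitz_of_uniform {γ : ℝ} {β : HBeta} {b : ℕ → ℝ} (hS : BetaSmoothInLast264 γ β)
    (h : BetaDerivsUniformInLast264 γ β b) : BetaDerivClause.LastVarLipschitz β (b 1) γ :=
  BetaDerivClause.lastVarLipschitz_of_derivBound (lastVarDerivBound_of_uniform hS h)

/-- **Markov bridge:** for a Markovian family `FlowStep.ofMarkov βM` the uniform reading IS the all-`k` form of the per-step
Markov shape `|∂ⁿ(βM (k+1))| ≤ b n` on `[0, γ]` (`B12BetaSmooth.BetaDerivBoundsAt`'s currency, one table for every step; `γ > 0` so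
that every box is inhabited). [cite: Balaban1987RG1, p.264 (β-clause after (1.22)) with (0.20) p.256 (bookkeeping: the Markov reading)] -/
theorem betaDerivsUniformInLast264_ofMarkov_iff {γ : ℝ} (hγ : 0 < γ) (βM : ℕ → ℝ → ℝ) (b : ℕ → ℝ) :
    BetaDerivsUniformInLast264 γ (ofMarkov βM) b ↔
      ∀ n k : ℕ, ∀ s ∈ Set.Icc (0 : ℝ) γ, ‖iteratedDerivWithin n (βM (k + 1)) (Set.Icc 0 γ) s‖ ≤ b n := by
  have key : ∀ (k : ℕ) (p : Fin (k + 1) → ℝ),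
      (fun s : ℝ => ofMarkov βM k (Function.update p (Fin.last k) s)) = βM (k + 1) := by
    intro k p
    funext s
    simp [ofMarkov]
  constructor
  · intro h n k s hs
    have hp : (fun _ : Fin (k + 1) => γ) ∈ Box γ k := mem_box.2 fun _ => ⟨hγ, le_rfl⟩
    have := h n k _ hp s hs
    rwa [key] at this
  · intro h n k p _ s hs
    rw [key]
    exact h n k s hs

end Literature.MathematicalPhysics.QuantumFieldTheory.Balaban1983to89.B12CouplingClausesHistory
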